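/-
Copyright (c) 2026 the pub-hodgecm-mathlib formalisation cell (harness21).  Prover seat hodgecm-mathlib-K2Liu-p13 (g2), Track B «K2-LIT»,
#184♮ = hLiu418 = `stmt-HodgeConjecture-24832`; Road I v3 organ U1-CT-ind STAGE 2 (Q2), file F7: the E1 DICTIONARY of term 1 (★ E1 `summable_borelSection_two`'s `hF`, parameter `s + ½`).
-/
import Summits.HodgeConjecture.HodgeConjecture.Theorems.K2LiuKlingenCellOneLeviLaw           -- ★ F5-d: `apply_transport_klingenLevi_of_upper_mul`, `detDelta_transport_klingenLevi_of_upper`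
import Summits.HodgeConjecture.HodgeConjecture.Theorems.K2LiuKlingenCellOneEisensteinU      -- ★ F5-f: `klingenLevi_one_mul`
import Summits.HodgeConjecture.HodgeConjecture.Theorems.K2LiuKlingenUnipotentAdelicChart    -- ★ F5-i: `continuous_nKlingenM`-style matrix continuity tools
import Summits.HodgeConjecture.HodgeConjecture.Theorems.K2E1BorelEisensteinGodementU2       -- ★ E1 (K2E1): `summable_borelSection_two` (Godement's criterion on `U(J₂)`)
import HarnessLib

/-!
# Crux `HLiu418`, Road I v3, organ U1 stage 2 (Q2), file F7: THE RESTRICTED SECTION OF TERM 1 IN E1's CURRENCY —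
# `S_h(b g) = χ(u)·(√‖u‖)^{2(s+½)+1}·S_h(g)` (`b₁₀ = 0`, `u = b₀₀`) and Godement's criterion: `Σ_q ‖S_h(γ̃_q g)‖ < ∞` for `re s > 0`

Cell `hodgecm-mathlib`, crux item hLiu418 = `stmt-HodgeConjecture-24832`; squad K2 ∕ K2Liu; LEAD F0P6-plan (g14), co-dealer K2E5-plan (g7); prover K2Liu-p13 (g2).
THEOREMS ONLY (no `def`, no instance, no notation, no named-fact hypothesis, no `sorry`); lane `--supports stmt-HodgeConjecture-24832 --as helper` (count-neutral).
THE K2Liu ∕ K2E1 DICTIONARY for term 1 of `E_Q` (★ F5-f `tsum_cellOne_eq_eisensteinSeriesU`): `S_h(y) = f(Ψ(jAdelic₄ m_Q^𝔸(1, (jAdelic 2)⁻¹ y)) · h)`, `f` a Siegel section of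
K2Liu's `I_Δ(s, χ)` (`χ(det_Δ)|det_Δ|^{s + n/2}`, `n = 2`).  By ★ F5-d, `det_Δ(Ψ(m_Q(1,b))) = b₀₀`, so
* **`restrictedSection_borel_law`**: `S_h(b·g) = χ(u)·(√‖u‖_𝔸)^{2(s+½)+1}·S_h(g)` for `b₁₀ = 0`, `u = b₀₀` — EXACTLY the hypothesis `hF` of ★ E1 `summable_borelSection_two` at the
  parameter `s + ½` (the unfolding of ★ `siegelDeltaCharacter = chiDet · modDelta^{2s+n}`, `chiDet = χ(u)`, `modDelta = √‖u‖`);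
* `continuous_restrictedSection` (clause (T1) BY VALUE, matrix level);
* **`summable_restrictedSection`**: for `χ` unitary and `0 < re s`, `Σ_{q ∈ B(L⁺)\U(J₂)(L⁺)} ‖S_h(toAdelic (out q) · g)‖ < ∞` for every `g` (★ E1 `summable_borelSection_two`, `½ < re(s+½)`) —
  GODEMENT CONVERGENCE OF TERM 1 of `E_Q` (`(∫β)·eisensteinSeriesU S_h`, ★ F5-f) on `re s > 0`, independently of (H).
[MoeglinWaldspurger1995, II.1.5, II.1.7], [Tan1999, §1], [Liu2021, §B.3 p. 101], [Garrett2018, §3.10].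
HONEST LABEL.  Count-neutral helper: `HC_CM` is proved only modulo the 7 printed citations (2 remaining named inputs: hLiu418 = `stmt-HodgeConjecture-24832`,
h413 = `stmt-HodgeConjecture-24833`) until rung 0 closes.
-/

set_option autoImplicit false
set_option linter.dupNamespace false -- the mandated namespace repeats `HodgeConjecture.HodgeConjecture`

noncomputable section

open scoped Matrix
open NumberField IsDedekindDomain MulAction

namespace Summit.HodgeConjecture.HodgeConjecture.Cruxes.HLiu418.K2LiuKlingenRestrictedSectionE1Law

open Literature.NumberTheory.Automorphic Literature.NumberTheory.Automorphic.UnitaryGroup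
open Literature.NumberTheory.GelbartRogawski1991 Literature.NumberTheory.GelbartRogawski1991.GRConstruction
open Literature.NumberTheory.GaloisRepresentations
open Literature.NumberTheory.K2Lit.SiegelDoubled
open Summit.HodgeConjecture.HodgeConjecture.Cruxes.HLiu418.K2LiuDoubledUTwoTwoBorelFrame
open Summit.HodgeConjecture.HodgeConjecture.Cruxes.HLiu418.K2LiuKlingenParabolicDefs
open Summit.HodgeConjecture.HodgeConjecture.Cruxes.HLiu418.K2LiuKlingenUnipotentAdelicDefs
open Summit.HodgeConjecture.HodgeConjecture.Cruxes.HLiu418.K2LiuKlingenCellOneLeviLaw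
open Summit.HodgeConjecture.HodgeConjecture.Cruxes.HLiu418.K2LiuKlingenCellOneEisensteinU (klingenLevi_one_mul)
open Summit.HodgeConjecture.HodgeConjecture.Cruxes.HLiu418.K2LiuSiegelDoubledLeviMatrix (conjAdele_conjAdele')
open Summit.HodgeConjecture.HodgeConjecture.Cruxes.H413.K2E1BorelEisensteinGodementU2 (summable_borelSection_two)
open UnitaryDualPair

variable {L : Type} [Field L] [NumberField L] [IsCMField L]
variable {N M : ℕ} {e : Fin N × Fin M ≃ Fin 2}
  {dV : Fin N → L} {hdV : ∀ i, IsCMField.complexConj L (dV i) = dV i}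
  {dW : Fin M → L} {hdW : ∀ i, IsCMField.complexConj L (dW i) = dW i}

section Transport

variable {SA : GL (Fin (2 + 2)) (AdeleRing (𝓞 L) L)}
  {Ψ : (quasiSplit (Fp L) L (IsCMField.complexConj L) (2 + 2)).Adelic ≃ₜ* HA L e dV hdV dW hdW} {X Y : Matrix (Fin 2) (Fin 2) (Fp L)} {a : Fp L}
  (hΨ : ∀ g : (quasiSplit (Fp L) L (IsCMField.complexConj L) (2 + 2)).Adelic,
    (((Ψ g : HA L e dV hdV dW hdW) : GL (Fin (2 + 2)) (AdeleRing (𝓞 L) L)) : Matrix (Fin (2 + 2)) (Fin (2 + 2)) (AdeleRing (𝓞 L) L)) =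
      (SA : Matrix (Fin (2 + 2)) (Fin (2 + 2)) (AdeleRing (𝓞 L) L)) *
        ((adelicVal (Fp L) L (IsCMField.complexConj L) (2 + 2) _ g : GL (Fin (2 + 2)) (AdeleRing (𝓞 L) L)) :
          Matrix (Fin (2 + 2)) (Fin (2 + 2)) (AdeleRing (𝓞 L) L)) *
        ((SA⁻¹ : GL (Fin (2 + 2)) (AdeleRing (𝓞 L) L)) : Matrix (Fin (2 + 2)) (Fin (2 + 2)) (AdeleRing (𝓞 L) L)))
  (ha : a + a = 1)
  (hSA : Matrix.reindex (e₂ (n := 2)).symm (e₂ (n := 2)).symm (SA : Matrix (Fin (2 + 2)) (Fin (2 + 2)) (AdeleRing (𝓞 L) L)) =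
    Matrix.fromBlocks (1 : Matrix (Fin 2) (Fin 2) (AdeleRing (𝓞 L) L)) (X.map ((algebraMap L (AdeleRing (𝓞 L) L)).comp (algebraMap (Fp L) L))) 1
      (-(X.map ((algebraMap L (AdeleRing (𝓞 L) L)).comp (algebraMap (Fp L) L)))))
  (hSAi : Matrix.reindex (e₂ (n := 2)).symm (e₂ (n := 2)).symm ((SA⁻¹ : GL (Fin (2 + 2)) (AdeleRing (𝓞 L) L)) : Matrix (Fin (2 + 2)) (Fin (2 + 2)) (AdeleRing (𝓞 L) L)) =
    Matrix.fromBlocks ((a • (1 : Matrix (Fin 2) (Fin 2) (Fp L))).map ((algebraMap L (AdeleRing (𝓞 L) L)).comp (algebraMap (Fp L) L)))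
      ((a • (1 : Matrix (Fin 2) (Fin 2) (Fp L))).map ((algebraMap L (AdeleRing (𝓞 L) L)).comp (algebraMap (Fp L) L)))
      (Y.map ((algebraMap L (AdeleRing (𝓞 L) L)).comp (algebraMap (Fp L) L)))
      (-(Y.map ((algebraMap L (AdeleRing (𝓞 L) L)).comp (algebraMap (Fp L) L)))))
  (hΨP : ∀ b : (quasiSplit (Fp L) L (IsCMField.complexConj L) (2 + 2)).Adelic,
    ((adelicVal (Fp L) L (IsCMField.complexConj L) (2 + 2) _ b : GL (Fin (2 + 2)) (AdeleRing (𝓞 L) L)) :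
        Matrix (Fin (2 + 2)) (Fin (2 + 2)) (AdeleRing (𝓞 L) L)).BlockTriangular id →
      IsSiegelDelta L e dV hdV dW hdW (Ψ b))

/-- the letter `(jAdelic 2)⁻¹ y` has the matrix `y.1`. [cite: Mok2014, §1 Notation p. 5] -/
theorem coe_jAdelic_two_symm (y : (quasiSplit (Fp L) L (IsCMField.complexConj L) 2).Adelic) :
    (((jAdelic L 2).symm y : unitaryGroupOfForm (conjAdele (Fp L) L (IsCMField.complexConj L)) ((StdForm.antidiagonal 2).over (AdeleRing (𝓞 L) L))) : GL (Fin 2) (AdeleRing (𝓞 L) L)) =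
      (y.1 : GL (Fin 2) (AdeleRing (𝓞 L) L)) := by
  rw [← adelicVal_jAdelic L 2 ((jAdelic L 2).symm y), MulEquiv.apply_symm_apply, adelicVal_apply]

include hΨ ha hSA hSAi hΨP in
/-- **THE BOREL LAW OF THE RESTRICTED SECTION IN E1's CURRENCY** (★ E1 `summable_borelSection_two`'s `hF` at the parameter `s + ½`): for `b, g ∈ U(J₂)(𝔸_{L⁺})`,
`u ∈ 𝔸_L^×` with `b₁₀ = 0`, `u = b₀₀`: `S_h(b g) = χ(u)·(√‖u‖)^{2(s+½)+1}·S_h(g)` (★ F5-d + the unfolding of ★ `siegelDeltaCharacter`).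
[cite: MoeglinWaldspurger1995, II.1.7] [cite: Tan1999, §1] [cite: Liu2021, §B.3 p. 101] -/
theorem restrictedSection_borel_law {χ : HeckeCharacter L} {s : ℂ} {f : HA L e dV hdV dW hdW → ℂ} (hf : IsSiegelDeltaSection L e dV hdV dW hdW χ s f) (h : HA L e dV hdV dW hdW)
    (b g : (quasiSplit (Fp L) L (IsCMField.complexConj L) 2).Adelic) (u : (AdeleRing (𝓞 L) L)ˣ) (hb : ((b.1 : GL (Fin 2) (AdeleRing (𝓞 L) L)) : Matrix (Fin 2) (Fin 2) (AdeleRing (𝓞 L) L)) 1 0 = 0) (hu : (u : AdeleRing (𝓞 L) L) = ((b.1 : GL (Fin 2) (AdeleRing (𝓞 L) L)) : Matrix (Fin 2) (Fin 2) (AdeleRing (𝓞 L) L)) 0 0) :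
    f (Ψ (jAdelic L 4 (klingenLevi (AdeleRing (𝓞 L) L) (conjAdele (Fp L) L (IsCMField.complexConj L)) (conjAdele_conjAdele' L) 1 ((jAdelic L 2).symm (b * g)))) * h) = ((χ u : ℂˣ) : ℂ) * ((Real.sqrt (ideleNorm u) : ℝ) : ℂ) ^ (2 * (s + 1 / 2) + 1) * f (Ψ (jAdelic L 4 (klingenLevi (AdeleRing (𝓞 L) L) (conjAdele (Fp L) L (IsCMField.complexConj L)) (conjAdele_conjAdele' L) 1 ((jAdelic L 2).symm g))) * h) := by
  have hbA : ((((jAdelic L 2).symm b : unitaryGroupOfForm (conjAdele (Fp L) L (IsCMField.complexConj L)) ((StdForm.antidiagonal 2).over (AdeleRing (𝓞 L) L))) : GL (Fin 2) (AdeleRing (𝓞 L) L)) :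
      Matrix (Fin 2) (Fin 2) (AdeleRing (𝓞 L) L)) 1 0 = 0 := by rw [coe_jAdelic_two_symm]; exact hb
  rw [map_mul (jAdelic L 2).symm, klingenLevi_one_mul, map_mul, map_mul, mul_assoc,
    apply_transport_klingenLevi_of_upper_mul hΨP hf 1 hbA]
  congr 1
  -- unfold the inducing character at `p = Ψ(m_Q(1, b))`: `det_Δ p = b₀₀ = u`
  have hdet : detDelta L e dV hdV dW hdW (Ψ (jAdelic L 4 (klingenLevi (AdeleRing (𝓞 L) L) (conjAdele (Fp L) L (IsCMField.complexConj L)) (conjAdele_conjAdele' L) 1 ((jAdelic L 2).symm b)))) = (u : AdeleRing (𝓞 L) L) := by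
    rw [detDelta_transport_klingenLevi_of_upper hΨ ha hSA hSAi 1 hbA, Units.val_one, one_mul, coe_jAdelic_two_symm, hu]
  have hunit : IsUnit (detDelta L e dV hdV dW hdW (Ψ (jAdelic L 4 (klingenLevi (AdeleRing (𝓞 L) L) (conjAdele (Fp L) L (IsCMField.complexConj L)) (conjAdele_conjAdele' L) 1 ((jAdelic L 2).symm b))))) := by rw [hdet]; exact u.isUnit
  have hunit_eq : hunit.unit = u := Units.ext (by rw [IsUnit.unit_spec, hdet])
  unfold siegelDeltaCharacter chiDet modDelta
  rw [dif_pos hunit, dif_pos hunit, hunit_eq]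
  congr 1
  push_cast
  ring_nf

/-- `m_Q(1, v⁻¹) = m_Q(1, v)⁻¹` (★ F1 `klingenLevi_mul`). [cite: Xiong2013, §7 Lemma 7.1] -/
theorem klingenLevi_one_inv {R : Type*} [CommRing R] {σ : R →+* R} (hσ : ∀ x, σ (σ x) = x) (v : unitaryGroupOfForm σ ((StdForm.antidiagonal 2).over R)) :
    klingenLevi R σ hσ 1 v⁻¹ = (klingenLevi R σ hσ 1 v)⁻¹ :=
  (inv_eq_of_mul_eq_one_right (by rw [klingenLevi_mul, mul_one, mul_inv_cancel, klingenLevi_one])).symm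

include hΨ in
/-- **the restricted section is continuous in `y`** (matrix level through clause (T1): `Ψ(m_Q(1, j₂⁻¹ y))` and its inverse have matrices `SA·m_Q(1, y^{±1})·SA⁻¹`).
[cite: MoeglinWaldspurger1995, II.1.5] -/
theorem continuous_restrictedSection {f : HA L e dV hdV dW hdW → ℂ} (hfc : Continuous f) (h : HA L e dV hdV dW hdW) :
    Continuous fun y : (quasiSplit (Fp L) L (IsCMField.complexConj L) 2).Adelic => f (Ψ (jAdelic L 4 (klingenLevi (AdeleRing (𝓞 L) L) (conjAdele (Fp L) L (IsCMField.complexConj L)) (conjAdele_conjAdele' L) 1 ((jAdelic L 2).symm y))) * h) := by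
  refine hfc.comp (Continuous.mul ?_ continuous_const)
  -- continuity of `y ↦ Ψ(jAdelic (m_Q(1, j₂⁻¹ y)))` into `H(𝔸)` at matrix level
  have hval : ∀ y : (quasiSplit (Fp L) L (IsCMField.complexConj L) 2).Adelic, Continuous fun y' : (quasiSplit (Fp L) L (IsCMField.complexConj L) 2).Adelic =>
      klingenLeviM (AdeleRing (𝓞 L) L) (conjAdele (Fp L) L (IsCMField.complexConj L)) 1 ((jAdelic L 2).symm y') := by
    intro _
    refine continuous_matrix fun i j => ?_
    have hB : Continuous fun y' : (quasiSplit (Fp L) L (IsCMField.complexConj L) 2).Adelic => (((((jAdelic L 2).symm y' : unitaryGroupOfForm (conjAdele (Fp L) L (IsCMField.complexConj L)) ((StdForm.antidiagonal 2).over (AdeleRing (𝓞 L) L))) :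
        GL (Fin 2) (AdeleRing (𝓞 L) L)) : Matrix (Fin 2) (Fin 2) (AdeleRing (𝓞 L) L))) := by
      simp_rw [coe_jAdelic_two_symm]
      exact Units.continuous_val.comp continuous_subtype_val
    fin_cases i <;> fin_cases j <;> simp [klingenLeviM] <;> first | exact continuous_const | exact (hB.matrix_elem _ _)
  refine continuous_induced_rng.2 (Units.continuous_iff.2 ⟨?_, ?_⟩)
  · have hm : ∀ y : (quasiSplit (Fp L) L (IsCMField.complexConj L) 2).Adelic, (((Ψ (jAdelic L 4 (klingenLevi (AdeleRing (𝓞 L) L) (conjAdele (Fp L) L (IsCMField.complexConj L)) (conjAdele_conjAdele' L) 1 ((jAdelic L 2).symm y))) : HA L e dV hdV dW hdW) : GL (Fin (2 + 2)) (AdeleRing (𝓞 L) L)) : Matrix (Fin (2 + 2)) (Fin (2 + 2)) (AdeleRing (𝓞 L) L)) =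
        (SA : Matrix (Fin (2 + 2)) (Fin (2 + 2)) (AdeleRing (𝓞 L) L)) * klingenLeviM (AdeleRing (𝓞 L) L) (conjAdele (Fp L) L (IsCMField.complexConj L)) 1 ((jAdelic L 2).symm y) *
          ((SA⁻¹ : GL (Fin (2 + 2)) (AdeleRing (𝓞 L) L)) : Matrix (Fin (2 + 2)) (Fin (2 + 2)) (AdeleRing (𝓞 L) L)) := fun y => by
      rw [hΨ, coe_adelicVal_jAdelic, coe_klingenLevi]
    exact ((continuous_const.mul (hval 1)).mul continuous_const).congr fun y => (hm y).symm
  · have hm : ∀ y : (quasiSplit (Fp L) L (IsCMField.complexConj L) 2).Adelic, (((((Ψ (jAdelic L 4 (klingenLevi (AdeleRing (𝓞 L) L) (conjAdele (Fp L) L (IsCMField.complexConj L)) (conjAdele_conjAdele' L) 1 ((jAdelic L 2).symm y))) : HA L e dV hdV dW hdW) : GL (Fin (2 + 2)) (AdeleRing (𝓞 L) L)))⁻¹ : GL (Fin (2 + 2)) (AdeleRing (𝓞 L) L)) :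
          Matrix (Fin (2 + 2)) (Fin (2 + 2)) (AdeleRing (𝓞 L) L)) =
        (SA : Matrix (Fin (2 + 2)) (Fin (2 + 2)) (AdeleRing (𝓞 L) L)) * klingenLeviM (AdeleRing (𝓞 L) L) (conjAdele (Fp L) L (IsCMField.complexConj L)) 1 ((jAdelic L 2).symm y⁻¹) *
          ((SA⁻¹ : GL (Fin (2 + 2)) (AdeleRing (𝓞 L) L)) : Matrix (Fin (2 + 2)) (Fin (2 + 2)) (AdeleRing (𝓞 L) L)) := fun y => by
      rw [← Subgroup.coe_inv, ← map_inv Ψ, ← map_inv (jAdelic L 4), ← klingenLevi_one_inv (conjAdele_conjAdele' L), ← map_inv (jAdelic L 2).symm, hΨ,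
        coe_adelicVal_jAdelic, coe_klingenLevi]
    exact ((continuous_const.mul ((hval 1).comp continuous_inv)).mul continuous_const).congr fun y => (hm y).symm

include hΨ ha hSA hSAi hΨP in
/-- **(Q2) F7 — GODEMENT CONVERGENCE OF TERM 1 OF `E_Q` ON `re s > 0`** (★ E1 `summable_borelSection_two` at the parameter `s + ½`): for `χ` unitary, `0 < re s`,
`f` a continuous Siegel section of `I_Δ(s,χ)` and `h ∈ H(𝔸)`, the E1 terms of ★ F5-f's `eisensteinSeriesU S_h g` are absolutely summable for every `g ∈ U(J₂)(𝔸_{L⁺})`.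
[cite: MoeglinWaldspurger1995, II.1.5] [cite: Garrett2018, §3.10] -/
theorem summable_restrictedSection (χ : HeckeCharacter L) (hχ : χ.IsUnitary) {s : ℂ} (hs : 0 < s.re)
    {f : HA L e dV hdV dW hdW → ℂ} (hf : IsSiegelDeltaSection L e dV hdV dW hdW χ s f) (hfc : Continuous f) (h : HA L e dV hdV dW hdW) (g : (quasiSplit (Fp L) L (IsCMField.complexConj L) 2).Adelic) :
    Summable fun q : Quotient (orbitRel
        ↥(borelU ((IsCMField.complexConj L : L ≃ₐ[Fp L] L) : L →+* L) ((StdForm.antidiagonal 2).over L))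
        ↥(unitaryGroupOfForm ((IsCMField.complexConj L : L ≃ₐ[Fp L] L) : L →+* L) ((StdForm.antidiagonal 2).over L))) =>
      ‖f (Ψ (jAdelic L 4 (klingenLevi (AdeleRing (𝓞 L) L) (conjAdele (Fp L) L (IsCMField.complexConj L)) (conjAdele_conjAdele' L) 1 ((jAdelic L 2).symm ((quasiSplit (Fp L) L (IsCMField.complexConj L) 2).toAdelic (Quotient.out q) * g)))) * h)‖ := by
  have hs' : (1 : ℝ) / 2 < (s + 1 / 2).re := by
    simp only [Complex.add_re, Complex.div_ofNat_re, Complex.one_re]; linarith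
  exact summable_borelSection_two L χ hχ (s + 1 / 2) hs' (F := fun y : (quasiSplit (Fp L) L (IsCMField.complexConj L) 2).Adelic => f (Ψ (jAdelic L 4 (klingenLevi (AdeleRing (𝓞 L) L) (conjAdele (Fp L) L (IsCMField.complexConj L)) (conjAdele_conjAdele' L) 1 ((jAdelic L 2).symm y))) * h)) (continuous_restrictedSection hΨ hfc h)
    (fun b g' u hb hu => restrictedSection_borel_law hΨ ha hSA hSAi hΨP hf h b g' u hb hu) g

end Transport

end Summit.HodgeConjecture.HodgeConjecture.Cruxes.HLiu418.K2LiuKlingenRestrictedSectionE1Law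

end
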